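import Mathlib.Analysis.SpecialFunctions.Pow.Continuity
import Mathlib.Topology.Order.Compact
import Mathlib.Topology.Order.IntermediateValue
import Literature.Barriers.CriticalPhenomena.RigorousRGSmallParameterSladeReduction
import HarnessLib

/-!
# `RigorousRGSmallParameter` (Slade, Theorem 1.4.1): the identification of the critical point,
# proved from the renormalisation-group output on the critical curve

Second companion ("proof architecture") file of
`Literature/Barriers/CriticalPhenomena/RigorousRGSmallParameter.lean`, one printed layer below
`RigorousRGSmallParameterSladeReduction.lean`. Source: G. Slade, *Critical exponents for long-range
`O(n)` models below the upper critical dimension*, CMP 358 (2018), arXiv:1611.06169 (held; page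
numbers below are arXiv PDF pages).

## Where this sits in the printed proof

The barrier `RigorousRGSmallParameter` is literally `LongRangePhi4.Slade2017_thm141` (Theorem
1.4.1, first display, `n ≥ 1`). The sibling file proves it from
`LongRangePhi4.Slade2017_susceptibilityDiffIneq`, the conclusions of §8.2–§8.3 stated in the
`ν`-parametrisation: on `(ν_c, ν_c + η]` the infinite-volume susceptibility exists, is
differentiable, obeys `-χ^{-2+γ̂ε/α+O(ε²)}∂χ/∂ν ≍ 1`, and diverges at `ν_c⁺` (that is Slade's
"Proof of Theorem 1.4.1" paragraph, p. 37). One layer below, the paper obtains those conclusions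
from the output of the renormalisation-group flow, which is parametrised NOT by `ν` but by the
mass `m² ∈ [0, δ]` along the *critical curve* `ν*(m²) = ν₀ᶜ(m²) + m²` (§8.2, before Proposition
8.2.2; §8.3, first display): Proposition 8.2.2 (p. 36) gives, for `m² ∈ (0, δ]`, the existence of
`χ̂ = lim_N χ̂_N(m², ν₀ᶜ(m²)) = lim_N χ_N(g, ν*(m²))` with `χ̂ = m⁻²(1 + O(s̄))`, and of the
`ν`-derivative with `χ̂' ≍ -m^{-4+2γ̂ε/α+O(ε²)}` ("there is a constant `c` such that
`c⁻¹m^{-4+2γ̂ε/α+cε²} ≤ -∂χ/∂ν(ν*) ≤ cm^{-4+2γ̂ε/α-cε²}`", first display after Remark 8.2.3,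
p. 37); Corollaries 7.2.4–7.2.5 (p. 30) make `ν*` continuous on `[0, δ]` ("Since
`ν* : [0,δ] → ℝ` is continuous by Corollaries 7.2.4–7.2.5", proof of Theorem 8.3.1). From these,
**Theorem 8.3.1** (p. 37: `ν_c = lim_{m²↓0} ν*(m²)` is the critical value and `χ ↑ ∞` as
`ν ↓ ν_c`) is a soft argument: `N = ν*([0,δ])` is a closed interval, `χ` is strictly decreasing
on `N₊ = ν*((0,δ])` because `χ' < 0` there, `χ(ν*(m²)) → ∞` as `m² ↓ 0`, hence the left endpoint
of `N` is not in `N₊`, equals `ν*(0) = ν_c`, and `N₊ = (ν_c, ν_c + η]`. (The differential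
inequality `-χ(ν*)^{-2+γ̂ε/α+O(ε²)}∂χ/∂ν(ν*) ≍ 1` is the second display after Remark 8.2.3; the
held text shows the fragment `1-bis` of its label, and we call it "`(1-bis)`" below.)

## What this file does

* `LongRangePhi4.Slade2017_criticalCurve` — named fact (not proved; it is the output of the
  renormalisation-group analysis of §5–§8.2, i.e. of the Bauerschmidt–Brydges–Slade theory, the
  XL part of any discharge): Proposition 8.2.2 + the first display after Remark 8.2.3 + the
  continuity of the critical curve, in the paper's own `m²`-parametrisation, with the quantifier
  prefix and the reading of the constants of `Slade2017_thm141` (uniform in `ε, g, m²`; dependent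
  on `d, n, L`; this is the convention opening §8.1: "for some positive `δ` and `c`, and for all
  `ε ∈ (0,δ]`").
* `LongRangePhi4.Slade2017_susceptibilityDiffIneq_of_criticalCurve` — **Theorem 8.3.1 and the
  display `(1-bis)` in its `χ`-form, PROVED** from the named fact: the topological identification of the critical
  point, strict monotonicity, divergence, and the passage from the `m`-form of the derivative
  bounds to the `χ`-form `-χ^{-2+γ̂ε/α+r}χ' ∈ [C'⁻¹, C']`, `|r| ≤ C'ε²` (using `χ(ν*) ≍ m⁻²`), with
  explicit constants (`ε₀' = min ε₀ (1/(8(c+1)(C+1)))`, `C' = 8C + 8`, `δ` shrunk to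
  `min (δ/2) (1/2)`).
* `LongRangePhi4.Slade2017_thm141_of_criticalCurve`, `rigorousRGSmallParameter_of_criticalCurve` —
  the composite with the sibling file: Theorem 1.4.1, hence the barrier, from the RG output on the
  critical curve.

After this file the unproved remainder of the barrier is exactly `Slade2017_criticalCurve`, whose
printed proof is Lemma 8.2.1 (`χ̂_N = m⁻² + m⁻⁴|Λ_N|⁻¹D²Z_N(0;𝟙,𝟙)/Z_N(0)`, Gaussian integration by
parts) fed with the representation `Z_N = e^{-u_N|Λ|}(I_N + K_N)` and the flow estimates of
Theorems 6.3.1, 7.2.2, 7.3.1 and Lemmas 8.1.1–8.1.6 — the renormalisation-group theory proper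
([BS-rg-norm], [BS-rg-loc], [BS-rg-IE], [BS-rg-step], [BBS-rg-pt]); not attempted (triage XL).
Not transcribed: `n = 0`; the formulas `χ̂ = m⁻² - ν_∞m⁻⁴`, `χ̂' = -ν'_∞m⁻⁴`; the identification
`χ̂' = lim_N ∂χ_N/∂ν`; `ν_c = -(n+2)C₀₀(0)g(1+O(g))`.

Barrier audit 2026-08-17 (append-only, last section): clause (a) of `Slade2017_criticalCurve`
(continuity of the critical curve) is load-bearing for Theorem 8.3.1 —
`LongRangePhi4.criticalCurve_continuity_loadBearing` exhibits a discontinuous curve satisfying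
clauses (b)–(c) verbatim for which the conclusion of Theorem 8.3.1 fails — and the printed proof
of that continuity (Corollary 7.2.4, "In particular") composes joint continuity on `Δ` with the
step function `m² ↦ m²₋(m²)`; the one-line repair (a continuous selection of the auxiliary mass)
is recorded in that theorem's docstring. The statement of the named fact is unchanged.
-/

noncomputable section

namespace Literature.Barriers.CriticalPhenomena

open Filter Set
open scoped _root_.Topology

namespace LongRangePhi4

/-! ### The renormalisation-group output on the critical curve (named fact) -/

/-- **Slade, Proposition 8.2.2 with the first display after Remark 8.2.3 and Corollaries
7.2.4–7.2.5: the susceptibility along the critical curve** (named fact, not proved here — it is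
the output of the renormalisation-group flow of §5–§8.2). In the setting of Theorem 1.4.1 —
`d = 1,2,3`, `α = (d+ε)/2`, `L` large then `ε` small, `s̄ ≍ ε`, `g ∈ [63/64 s̄, 65/64 s̄]`, spin
case `n ≥ 1` — there are `δ > 0`, the critical curve `ν* : [0,δ] → ℝ`,
`ν*(m²) = ν₀ᶜ(m²) + m²` (§8.2 before Proposition 8.2.2; §8.3 first display), and the
infinite-volume susceptibility `χ` such that:
(a) "`ν* : [0,δ] → ℝ` is continuous by Corollaries 7.2.4–7.2.5" (proof of Theorem 8.3.1;
Corollary 7.2.4: "`μ₀(m²)` is continuous in `m² ∈ (0,δ]`", Corollary 7.2.5: "The limit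
`lim_{m²↓0} μ₀(m²)` exists and equals `μ₀(0)`", with `ν₀ᶜ(m²) = μ₀(m²) - (n+2)C₀₀(m²)g`);
(b) for every `m² ∈ (0,δ]` the infinite-volume limit
`χ(g, ν*(m²); n) = lim_{N→∞} χ_N(g, ν₀ᶜ(m²) + m²) = lim_N χ̂_N(m², ν₀ᶜ(m²))` exists (Proposition
8.2.2: "the limits `χ̂ = lim_{N→∞} χ̂_N(m², ν₀ᶜ(m²))` … exist", with
`χ_N(g, ν₀ + m²) = χ̂_N(m², g, ν₀)`, §4.1 last display and §8.2 first display) and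
"`χ̂ = m⁻²(1 + O(s̄))`" (Proposition 8.2.2, first formula), rendered `|m²χ - 1| ≤ C s̄`;
(c) for every `m² ∈ (0,δ)` the function `ν ↦ χ(g,ν;n)` has a derivative at `ν*(m²)` ("`χ̂'` is
in fact the derivative of `χ̂`", end of the proof of Proposition 8.2.2; "`∂χ_N/∂ν(g,ν*) =
χ̂'_N(m²,g,ν₀ᶜ)`", after Remark 8.2.3) and "there is a constant `c` such that
`c⁻¹m^{-4+2γ̂ε/α+cε²} ≤ -∂χ/∂ν(ν*) ≤ cm^{-4+2γ̂ε/α-cε²}`", `γ̂ = (n+2)/(n+8)` (first display after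
Remark 8.2.3), written in the variable `m²` (for `m² ≤ 1` the printed bounds with `c` imply these
with `C = c`; the open interval `(0,δ)` is where the proof of Proposition 8.2.2 interchanges limit
and derivative, "uniform on compact subsets of `m² ∈ (0,δ)`").
Quantifier prefix and READING of the constants (`c` of `s̄ ≍ ε` and `C` uniform in `ε, g, m²`;
dependent on `d, n, L`; `δ`, `ν*`, `χ` chosen after `g`) as in `Slade2017_thm141` and
`Slade2017_susceptibilityDiffIneq`; cf. the convention opening §8.1. Not transcribed: `n = 0`;
`χ̂ = m⁻² - ν_∞m⁻⁴`, `χ̂' = -ν'_∞m⁻⁴ ≍ -m^{-4}m^{2γ̂ε/α+O(ε²)}` as formulas in the flow; that the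
derivative is the limit of the finite-volume derivatives; `ν*(0) = ν_c = -(n+2)C₀₀(0)g(1+O(g))`.
[cite: Slade2017, Proposition 8.2.2, first display after Remark 8.2.3, Corollaries 7.2.4–7.2.5] -/
def Slade2017_criticalCurve : Prop :=
  ∀ (d n : ℕ), (d = 1 ∨ d = 2 ∨ d = 3) → 1 ≤ n →
    ∃ L₀ : ℕ, ∀ L : ℕ, L₀ ≤ L →
      ∃ ε₀ c C : ℝ, 0 < ε₀ ∧ 0 < c ∧ 0 < C ∧
        ∀ ε : ℝ, 0 < ε → ε < ε₀ →
          ∃ s : ℝ, ε / c ≤ s ∧ s ≤ c * ε ∧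
            ∀ g : ℝ, 63 / 64 * s ≤ g → g ≤ 65 / 64 * s →
              ∃ δ : ℝ, 0 < δ ∧ ∃ νstar χ : ℝ → ℝ,
                ContinuousOn νstar (Icc 0 δ) ∧
                (∀ m2 ∈ Ioc 0 δ,
                  HasSusceptibility d n L ((d + ε) / 2) g (νstar m2) (χ (νstar m2)) ∧
                    |m2 * χ (νstar m2) - 1| ≤ C * s) ∧
                (∀ m2 ∈ Ioo 0 δ, ∃ D : ℝ, HasDerivAt χ D (νstar m2) ∧
                  C⁻¹ * m2 ^ (-2 + ((n : ℝ) + 2) / ((n : ℝ) + 8) * (ε / ((d + ε) / 2)) + C * ε ^ 2)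
                      ≤ -D ∧
                  -D ≤ C * m2 ^ (-2 + ((n : ℝ) + 2) / ((n : ℝ) + 8) * (ε / ((d + ε) / 2))
                      - C * ε ^ 2))

/-! ### Two elementary lemmas used in the passage from the `m`-form to the `χ`-form -/

/-- Choice of the exponent `r ∈ [-κ, κ]`: if `X ≥ 1`, `B ≥ 1`, and the continuous function
`r ↦ X^{-2+θ+r}y` is `≥ B⁻¹` at `r = κ` and `≤ B` at `r = -κ`, then some `r ∈ [-κ, κ]` puts it
inside `[B⁻¹, B]` (one of the endpoints, or the intermediate value theorem). [folklore] -/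
theorem exists_exponent_in_band {X y θ κ B : ℝ} (hX : 1 ≤ X) (hκ : 0 ≤ κ) (hB : 1 ≤ B)
    (hlo : B⁻¹ ≤ X ^ (-2 + θ + κ) * y) (hhi : X ^ (-2 + θ + -κ) * y ≤ B) :
    ∃ r : ℝ, |r| ≤ κ ∧ B⁻¹ ≤ X ^ (-2 + θ + r) * y ∧ X ^ (-2 + θ + r) * y ≤ B := by
  have hX0 : 0 < X := one_pos.trans_le hX
  have hBinv1 : B⁻¹ ≤ 1 := inv_le_one_of_one_le₀ hB
  have hcont : Continuous fun r : ℝ => X ^ (-2 + θ + r) * y :=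
    (continuous_const.rpow (continuous_const.add continuous_id) fun _ => Or.inl hX0.ne').mul
      continuous_const
  by_cases h1 : B⁻¹ ≤ X ^ (-2 + θ + -κ) * y
  · exact ⟨-κ, by rw [abs_neg, abs_of_nonneg hκ], h1, hhi⟩
  by_cases h2 : X ^ (-2 + θ + κ) * y ≤ B
  · exact ⟨κ, by rw [abs_of_nonneg hκ], hlo, h2⟩
  push Not at h1 h2
  have hκκ : -κ ≤ κ := by linarith
  have hmem : (1 : ℝ) ∈ Icc (X ^ (-2 + θ + -κ) * y) (X ^ (-2 + θ + κ) * y) :=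
    ⟨by linarith, by linarith⟩
  obtain ⟨r, hr, hr1⟩ := intermediate_value_Icc hκκ hcont.continuousOn hmem
  refine ⟨r, abs_le.2 ⟨hr.1, hr.2⟩, ?_, ?_⟩
  · simp only at hr1
    rw [hr1]
    exact hBinv1
  · simp only at hr1
    rw [hr1]
    exact hB

/-- From the `m`-form to the `χ`-form at one point of the critical curve: if
`½ ≤ m²X ≤ 3/2` (`X = χ(ν*(m²))`, from `χ̂ = m⁻²(1+O(s̄))`) and
`C⁻¹(m²)^{-2+θ+κ} ≤ y ≤ C(m²)^{-2+θ-κ}` (`y = -∂χ/∂ν(ν*)`, the first display after Remark 8.2.3),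
with `0 ≤ θ`, `0 ≤ κ`, `θ + κ ≤ ½`, then `(8C+8)⁻¹ ≤ X^{-2+θ+κ}y` and `X^{-2+θ-κ}y ≤ 8C+8` — the
two one-sided forms of "`-χ(ν*)^{-2+γ̂ε/α+O(ε²)}∂χ/∂ν(ν*) ≍ 1`" (the display `(1-bis)`).
[cite: Slade2017, second display after Remark 8.2.3] -/
theorem deriv_band_of_mass_param {X y m2 θ κ C : ℝ} (hC : 0 < C) (hm2 : 0 < m2)
    (hθ0 : 0 ≤ θ) (hκ0 : 0 ≤ κ) (hθκ : θ + κ ≤ 1 / 2)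
    (hXlo : 1 / 2 ≤ m2 * X) (hXhi : m2 * X ≤ 3 / 2) (hX0 : 0 < X)
    (hylo : C⁻¹ * m2 ^ (-2 + θ + κ) ≤ y) (hyhi : y ≤ C * m2 ^ (-2 + θ + -κ)) :
    (8 * C + 8)⁻¹ ≤ X ^ (-2 + θ + κ) * y ∧ X ^ (-2 + θ + -κ) * y ≤ 8 * C + 8 := by
  have hXm0 : 0 < X * m2 := mul_pos hX0 hm2
  have hXm_lo : 1 / 2 ≤ X * m2 := by rwa [mul_comm] at hXlo
  have hXm_hi : X * m2 ≤ 3 / 2 := by rwa [mul_comm] at hXhi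
  constructor
  · -- lower bound: `X^{-p₁} y ≥ C⁻¹ (X m²)^{-p₁} ≥ C⁻¹ (3/2)^{-2}`
    have e1 : -2 + θ + κ = -(2 - θ - κ) := by ring
    have hpow : (X * m2) ^ (2 - θ - κ) ≤ 9 / 4 := by
      calc (X * m2) ^ (2 - θ - κ) ≤ (3 / 2 : ℝ) ^ (2 - θ - κ) :=
            Real.rpow_le_rpow hXm0.le hXm_hi (by linarith)
        _ ≤ (3 / 2 : ℝ) ^ (2 : ℝ) :=
            Real.rpow_le_rpow_of_exponent_le (by norm_num) (by linarith)
        _ = 9 / 4 := by norm_num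
    have hinv : 4 / 9 ≤ (X * m2) ^ (-2 + θ + κ) := by
      rw [e1, Real.rpow_neg hXm0.le]
      rw [show (4 / 9 : ℝ) = (9 / 4)⁻¹ by norm_num]
      exact inv_anti₀ (Real.rpow_pos_of_pos hXm0 _) hpow
    have hstep : C⁻¹ * (4 / 9) ≤ X ^ (-2 + θ + κ) * y := by
      calc C⁻¹ * (4 / 9) ≤ C⁻¹ * (X * m2) ^ (-2 + θ + κ) :=
            mul_le_mul_of_nonneg_left hinv (inv_pos.2 hC).le
        _ = X ^ (-2 + θ + κ) * (C⁻¹ * m2 ^ (-2 + θ + κ)) := by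
            rw [Real.mul_rpow hX0.le hm2.le]; ring
        _ ≤ X ^ (-2 + θ + κ) * y :=
            mul_le_mul_of_nonneg_left hylo (Real.rpow_nonneg hX0.le _)
    refine le_trans ?_ hstep
    calc (8 * C + 8)⁻¹ ≤ (9 / 4 * C)⁻¹ := inv_anti₀ (by positivity) (by linarith)
      _ = C⁻¹ * (4 / 9) := by rw [mul_inv]; norm_num; ring
  · -- upper bound: `X^{-p₂} y ≤ C (X m²)^{-p₂} ≤ C (1/2)^{-3}`
    have e2 : -2 + θ + -κ = -(2 - θ + κ) := by ring
    have hpow : 1 / 8 ≤ (X * m2) ^ (2 - θ + κ) := by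
      calc (1 / 8 : ℝ) = (1 / 2 : ℝ) ^ (3 : ℝ) := by norm_num
        _ ≤ (1 / 2 : ℝ) ^ (2 - θ + κ) :=
            Real.rpow_le_rpow_of_exponent_ge (by norm_num) (by norm_num) (by linarith)
        _ ≤ (X * m2) ^ (2 - θ + κ) := Real.rpow_le_rpow (by norm_num) hXm_lo (by linarith)
    have hinv : (X * m2) ^ (-2 + θ + -κ) ≤ 8 := by
      rw [e2, Real.rpow_neg hXm0.le]
      rw [show (8 : ℝ) = (1 / 8)⁻¹ by norm_num]
      exact inv_anti₀ (by norm_num) hpow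
    have hy0 : 0 ≤ y := le_trans (by positivity) hylo
    calc X ^ (-2 + θ + -κ) * y ≤ X ^ (-2 + θ + -κ) * (C * m2 ^ (-2 + θ + -κ)) :=
          mul_le_mul_of_nonneg_left hyhi (Real.rpow_nonneg hX0.le _)
      _ = C * (X * m2) ^ (-2 + θ + -κ) := by rw [Real.mul_rpow hX0.le hm2.le]; ring
      _ ≤ C * 8 := mul_le_mul_of_nonneg_left hinv hC.le
      _ ≤ 8 * C + 8 := by linarith

/-! ### Theorem 8.3.1 and `(1-bis)`: the §8.2–§8.3 conclusions from the critical curve -/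

/-- **Slade, Theorem 8.3.1 (identification of the critical point, divergence of the
susceptibility) together with the display `(1-bis)`, formalised**: the renormalisation-group
output on the critical curve (`Slade2017_criticalCurve`) implies the `ν`-parametrised conclusions
of §8.2–§8.3 (`Slade2017_susceptibilityDiffIneq`). The printed argument (p. 37): "Since
`ν* : [0,δ] → ℝ` is continuous … `N` is a closed interval. … `N = [x_c, x_c + η]` with `η > 0`.
… `χ(ν*(m²)) < ∞` for `m² > 0` whereas `χ(ν*(m²)) → ∞` as `m² ↓ 0`. … we do know … that
`χ'(ν) < 0` for each `ν ∈ N₊`, so `χ` is strictly monotone decreasing in `ν ∈ N₊`.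
Therefore, the only point in `N` at which `χ` can be infinite is `x_c`, and we must have
`ν*(m²) → x_c` as `m² ↓ 0`. It follows that `x_c = ν_c`, and it also follows that `χ(ν) ↑ ∞` as
`ν ↓ ν_c`." Here: `δ` is first shrunk to `δ' = min (δ/2) (1/2)` (so that derivatives exist on all
of `ν*((0,δ'])` and `χ ≥ 1` there), `N₊ = ν*((0,δ'])` is an interval on which `χ` is strictly
decreasing, `inf N ∉ N₊` by unboundedness, hence `inf N = ν*(0) =: ν_c` and `N₊ = (ν_c, sup N]`;
the `χ`-form of the derivative bounds is `deriv_band_of_mass_param` with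
`exists_exponent_in_band`. Constants: `ε₀' = min ε₀ (1/(8(c+1)(C+1)))`, `c' = c`, `C' = 8C + 8`.
[cite: Slade2017, Theorem 8.3.1 and its proof; second display after Remark 8.2.3] -/
theorem Slade2017_susceptibilityDiffIneq_of_criticalCurve (h : Slade2017_criticalCurve) :
    Slade2017_susceptibilityDiffIneq := by
  intro d n hd hn
  obtain ⟨L₀, hL₀⟩ := h d n hd hn
  refine ⟨L₀, fun L hL => ?_⟩
  obtain ⟨ε₀, c, C, hε₀, hc, hC, hmain⟩ := hL₀ L hL
  clear hL₀
  -- the new constants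
  set K : ℝ := 8 * (c + 1) * (C + 1) with hK_def
  have hK : 0 < K := by positivity
  have hK8 : 8 ≤ K := by
    have : (1 : ℝ) ≤ (c + 1) * (C + 1) := by nlinarith
    rw [hK_def]; nlinarith
  refine ⟨min ε₀ (1 / K), c, 8 * C + 8, lt_min hε₀ (by positivity), hc, by positivity,
    fun ε hε hεlt => ?_⟩
  have hεε₀ : ε < ε₀ := hεlt.trans_le (min_le_left _ _)
  have hεK : ε ≤ 1 / K := (hεlt.trans_le (min_le_right _ _)).le
  have hε8 : ε ≤ 1 / 8 := hεK.trans (one_div_le_one_div_of_le (by norm_num) hK8)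
  have hε1 : ε ≤ 1 := hε8.trans (by norm_num)
  have hCε : C * ε ≤ 1 / 8 := by
    have h1 : C * ε ≤ C * (1 / K) := mul_le_mul_of_nonneg_left hεK hC.le
    have h2 : C * (1 / K) ≤ 1 / 8 := by
      rw [mul_one_div, div_le_iff₀ hK, hK_def]
      nlinarith
    exact h1.trans h2
  have hcCε : c * C * ε ≤ 1 / 8 := by
    have h1 : c * C * ε ≤ c * C * (1 / K) := mul_le_mul_of_nonneg_left hεK (by positivity)
    have h2 : c * C * (1 / K) ≤ 1 / 8 := by
      rw [mul_one_div, div_le_iff₀ hK, hK_def]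
      nlinarith
    exact h1.trans h2
  have hκ : C * ε ^ 2 ≤ 1 / 8 := by
    calc C * ε ^ 2 = C * ε * ε := by ring
      _ ≤ 1 / 8 * 1 := mul_le_mul hCε hε1 hε.le (by norm_num)
      _ = 1 / 8 := by norm_num
  have hκ0 : 0 ≤ C * ε ^ 2 := by positivity
  -- the exponent `θ = γ̂ε/α`
  have hd0 : (0 : ℝ) ≤ d := Nat.cast_nonneg d
  have hd1 : (1 : ℝ) ≤ d := by rcases hd with rfl | rfl | rfl <;> norm_num
  have hθ0 : 0 ≤ ((n : ℝ) + 2) / ((n : ℝ) + 8) * (ε / ((d + ε) / 2)) := by positivity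
  have hθ2 : ((n : ℝ) + 2) / ((n : ℝ) + 8) * (ε / ((d + ε) / 2)) ≤ 2 * ε := by
    have h1 : ((n : ℝ) + 2) / ((n : ℝ) + 8) ≤ 1 := by
      rw [div_le_one (by positivity)]
      linarith
    have h2 : ε / ((d + ε) / 2) ≤ 2 * ε := by
      rw [div_le_iff₀ (by positivity)]
      nlinarith
    calc ((n : ℝ) + 2) / ((n : ℝ) + 8) * (ε / ((d + ε) / 2))
        ≤ 1 * (2 * ε) := mul_le_mul h1 h2 (by positivity) zero_le_one
      _ = 2 * ε := one_mul _
  generalize hθ_def : ((n : ℝ) + 2) / ((n : ℝ) + 8) * (ε / ((d + ε) / 2)) = θ at hθ0 hθ2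
  have hθκ : θ + C * ε ^ 2 ≤ 1 / 2 := by linarith
  -- `s̄` and `g`
  obtain ⟨s, hs1, hs2, hg⟩ := hmain ε hε hεε₀
  clear hmain
  have hCs : C * s ≤ 1 / 2 := by
    calc C * s ≤ C * (c * ε) := mul_le_mul_of_nonneg_left hs2 hC.le
      _ = c * C * ε := by ring
      _ ≤ 1 / 2 := hcCε.trans (by norm_num)
  refine ⟨s, hs1, hs2, fun g hg1 hg2 => ?_⟩
  obtain ⟨δ, hδ, νs, χ, hνs, hval, hder⟩ := hg g hg1 hg2
  clear hg
  rw [hθ_def] at hder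
  -- shrink `δ`
  set δ' : ℝ := min (δ / 2) (1 / 2) with hδ'_def
  have hδ'0 : 0 < δ' := lt_min (half_pos hδ) (by norm_num)
  have hδ'δ : δ' < δ := (min_le_left _ _).trans_lt (half_lt_self hδ)
  have hδ'h : δ' ≤ 1 / 2 := min_le_right _ _
  have hIoc : ∀ m2 ∈ Ioc 0 δ', m2 ∈ Ioc 0 δ := fun m2 hm => ⟨hm.1, hm.2.trans hδ'δ.le⟩
  have hIoo : ∀ m2 ∈ Ioc 0 δ', m2 ∈ Ioo 0 δ := fun m2 hm => ⟨hm.1, hm.2.trans_lt hδ'δ⟩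
  -- pointwise consequences on `(0, δ']`
  have hband : ∀ m2 ∈ Ioc 0 δ', 1 / 2 ≤ m2 * χ (νs m2) ∧ m2 * χ (νs m2) ≤ 3 / 2 := by
    intro m2 hm
    have hh := (abs_le.1 ((hval m2 (hIoc m2 hm)).2.trans hCs))
    constructor <;> linarith [hh.1, hh.2]
  have hone : ∀ m2 ∈ Ioc 0 δ', 1 ≤ χ (νs m2) := by
    intro m2 hm
    have h1 := (hband m2 hm).1
    have hm1 : m2 ≤ 1 / 2 := hm.2.trans hδ'h
    by_contra hlt
    push Not at hlt
    have : m2 * χ (νs m2) < m2 * 1 := by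
      rcases le_or_gt 0 (χ (νs m2)) with h0 | h0
      · exact mul_lt_mul_of_pos_left hlt hm.1
      · calc m2 * χ (νs m2) < 0 := mul_neg_of_pos_of_neg hm.1 h0
          _ < m2 * 1 := by linarith [hm.1]
    linarith
  have hder' : ∀ m2 ∈ Ioc 0 δ', ∃ D : ℝ, HasDerivAt χ D (νs m2) ∧
      C⁻¹ * m2 ^ (-2 + θ + C * ε ^ 2) ≤ -D ∧ -D ≤ C * m2 ^ (-2 + θ - C * ε ^ 2) :=
    fun m2 hm => hder m2 (hIoo m2 hm)
  have hDpos : ∀ m2 ∈ Ioc 0 δ', ∀ D : ℝ, C⁻¹ * m2 ^ (-2 + θ + C * ε ^ 2) ≤ -D → D < 0 := by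
    intro m2 hm D hD
    have : 0 < C⁻¹ * m2 ^ (-2 + θ + C * ε ^ 2) :=
      mul_pos (inv_pos.2 hC) (Real.rpow_pos_of_pos hm.1 _)
    linarith
  -- unboundedness along `m² ↓ 0`
  have hunb : ∀ M : ℝ, ∃ m2 ∈ Ioc 0 δ', M < χ (νs m2) := by
    intro M
    have hM1 : 0 < |M| + 1 := by positivity
    refine ⟨min δ' (1 / (2 * (|M| + 1))), ⟨lt_min hδ'0 (by positivity), min_le_left _ _⟩, ?_⟩
    set m2 := min δ' (1 / (2 * (|M| + 1))) with hm2_def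
    have hm2pos : 0 < m2 := lt_min hδ'0 (by positivity)
    have hm2mem : m2 ∈ Ioc 0 δ' := ⟨hm2pos, min_le_left _ _⟩
    have h1 := (hband m2 hm2mem).1
    have hm2le : m2 ≤ 1 / (2 * (|M| + 1)) := min_le_right _ _
    have h2 : m2 * (|M| + 1) ≤ 1 / 2 := by
      calc m2 * (|M| + 1) ≤ 1 / (2 * (|M| + 1)) * (|M| + 1) :=
            mul_le_mul_of_nonneg_right hm2le hM1.le
        _ = 1 / 2 := by field_simp
    have h3 : m2 * (|M| + 1) ≤ m2 * χ (νs m2) := h2.trans h1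
    have h4 : |M| + 1 ≤ χ (νs m2) := le_of_mul_le_mul_left h3 hm2pos
    linarith [le_abs_self M]
  -- the sets `N₊ = ν*((0,δ'])` and `N = ν*([0,δ']) = [a, b]`
  set Np : Set ℝ := νs '' Ioc 0 δ' with hNp_def
  have hνs' : ContinuousOn νs (Icc 0 δ') := hνs.mono (Icc_subset_Icc le_rfl hδ'δ.le)
  have hNp_ord : OrdConnected Np :=
    (isPreconnected_Ioc.image νs (hνs'.mono Ioc_subset_Icc_self)).ordConnected
  have hχcont : ContinuousOn χ Np := by
    rintro x ⟨m2, hm, rfl⟩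
    obtain ⟨D, hD, -⟩ := hder' m2 hm
    exact hD.continuousAt.continuousWithinAt
  have hχderiv : ∀ x ∈ interior Np, deriv χ x < 0 := by
    intro x hx
    obtain ⟨m2, hm, rfl⟩ := interior_subset hx
    obtain ⟨D, hD, hlo, -⟩ := hder' m2 hm
    rw [hD.deriv]
    exact hDpos m2 hm D hlo
  have hanti : StrictAntiOn χ Np := strictAntiOn_of_deriv_neg hNp_ord.convex hχcont hχderiv
  set a : ℝ := sInf (νs '' Icc 0 δ') with ha_def
  set b : ℝ := sSup (νs '' Icc 0 δ') with hb_def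
  have hN : νs '' Icc 0 δ' = Icc a b := hνs'.image_Icc hδ'0.le
  have hNp_sub : ∀ x ∈ Np, x ∈ Icc a b := by
    rintro x ⟨m2, hm, rfl⟩
    rw [← hN]
    exact mem_image_of_mem νs (Ioc_subset_Icc_self hm)
  have h0mem : νs 0 ∈ Icc a b := by
    rw [← hN]
    exact mem_image_of_mem νs (left_mem_Icc.2 hδ'0.le)
  -- `a ∉ N₊`
  have ha_notin : a ∉ Np := by
    intro haNp
    obtain ⟨m2, hm, hM⟩ := hunb (χ a)
    have hmem : νs m2 ∈ Np := mem_image_of_mem νs hm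
    have hge : a ≤ νs m2 := (hNp_sub _ hmem).1
    have := hanti.antitoneOn haNp hmem hge
    linarith
  -- hence `a = ν*(0)`
  have ha0 : νs 0 = a := by
    have haN : a ∈ νs '' Icc 0 δ' := by
      rw [hN]
      exact left_mem_Icc.2 (h0mem.1.trans h0mem.2)
    obtain ⟨m2, hm, hm0⟩ := haN
    rcases eq_or_lt_of_le hm.1 with h | h
    · rw [← h] at hm0
      exact hm0
    · exact absurd (hm0 ▸ mem_image_of_mem νs ⟨h, hm.2⟩ : a ∈ Np) ha_notin
  -- and `N₊ = (a, b]`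
  have hNp_eq : Np = Ioc a b := by
    ext x
    constructor
    · intro hx
      refine ⟨lt_of_le_of_ne (hNp_sub x hx).1 (fun hax => ha_notin ?_), (hNp_sub x hx).2⟩
      rwa [← hax] at hx
    · intro hx
      have hxN : x ∈ νs '' Icc 0 δ' := by
        rw [hN]
        exact ⟨hx.1.le, hx.2⟩
      obtain ⟨m2, hm, rfl⟩ := hxN
      rcases eq_or_lt_of_le hm.1 with h | h
      · exfalso
        rw [← h, ha0] at hx
        exact lt_irrefl a hx.1
      · exact mem_image_of_mem νs ⟨h, hm.2⟩
  have hab : a < b := by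
    have : νs δ' ∈ Np := mem_image_of_mem νs ⟨hδ'0, le_rfl⟩
    rw [hNp_eq] at this
    exact this.1.trans_le this.2
  have hmemNp : ∀ x, a < x → x ≤ b → ∃ m2 ∈ Ioc 0 δ', νs m2 = x := by
    intro x h1 h2
    have : x ∈ Np := by
      rw [hNp_eq]
      exact ⟨h1, h2⟩
    exact this
  -- assemble
  refine ⟨a, b - a, sub_pos.2 hab, χ, ?_, ?_, ?_, ?_⟩
  · -- (i) existence of the infinite-volume limit on `(ν_c, ν_c + η]`
    intro ν hν
    obtain ⟨m2, hm, rfl⟩ := hmemNp ν hν.1 (by linarith [hν.2])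
    exact (hval m2 (hIoc m2 hm)).1
  · -- (ii) differentiability on `(ν_c, ν_c + η)`
    intro ν hν
    obtain ⟨m2, hm, rfl⟩ := hmemNp ν hν.1 (by linarith [hν.2])
    obtain ⟨D, hD, -⟩ := hder' m2 hm
    exact hD.differentiableAt.differentiableWithinAt
  · -- (iii) positivity and the differential inequality `(1-bis)`
    intro ν hν
    obtain ⟨m2, hm, rfl⟩ := hmemNp ν hν.1 (by linarith [hν.2])
    have hX1 := hone m2 hm
    refine ⟨one_pos.trans_le hX1, ?_⟩
    obtain ⟨D, hD, hlo, hhi⟩ := hder' m2 hm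
    rw [hD.deriv]
    have hhi' : -D ≤ C * m2 ^ (-2 + θ + -(C * ε ^ 2)) := by rwa [← sub_eq_add_neg]
    obtain ⟨hblo, hbhi⟩ := deriv_band_of_mass_param (y := -D) hC hm.1 hθ0 hκ0 hθκ
      (hband m2 hm).1 (hband m2 hm).2 (one_pos.trans_le hX1) hlo hhi'
    obtain ⟨r, hr, hrlo, hrhi⟩ := exists_exponent_in_band hX1 hκ0 (by linarith) hblo hbhi
    refine ⟨r, hr.trans (mul_le_mul_of_nonneg_right (by linarith) (sq_nonneg ε)), ?_, ?_⟩
    · rwa [neg_mul_eq_mul_neg]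
    · rwa [neg_mul_eq_mul_neg]
  · -- (iv) divergence at `ν_c⁺`
    rw [tendsto_atTop]
    intro M
    obtain ⟨m2, hm, hM⟩ := hunb M
    have hmem : νs m2 ∈ Ioc a b := by
      rw [← hNp_eq]
      exact mem_image_of_mem νs hm
    filter_upwards [Ioo_mem_nhdsGT hmem.1] with ν hν
    obtain ⟨m2', hm', rfl⟩ := hmemNp ν hν.1 (hν.2.le.trans hmem.2)
    have := hanti (mem_image_of_mem νs hm') (mem_image_of_mem νs hm) hν.2
    linarith

/-- Theorem 1.4.1, first display, `n ≥ 1` (`Slade2017_thm141`) from the renormalisation-group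
output on the critical curve: Theorem 8.3.1 (this file) followed by the final integration step
(`Slade2017_thm141_of_susceptibilityDiffIneq`, sibling file).
[cite: Slade2017, §8.3 (Theorem 8.3.1 and Proof of Theorem 1.4.1)] -/
theorem Slade2017_thm141_of_criticalCurve (h : Slade2017_criticalCurve) : Slade2017_thm141 :=
  Slade2017_thm141_of_susceptibilityDiffIneq (Slade2017_susceptibilityDiffIneq_of_criticalCurve h)

end LongRangePhi4

/-- The barrier `RigorousRGSmallParameter` (= Slade's Theorem 1.4.1, first display, `n ≥ 1`)
follows from the renormalisation-group output on the critical curve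
(`LongRangePhi4.Slade2017_criticalCurve`: Proposition 8.2.2, the first display after Remark
8.2.3, Corollaries 7.2.4–7.2.5) by §8.3 of the paper, all of which is now proved
(Theorem 8.3.1 here, the final integration in the sibling file).
[cite: Slade2017, §8.3] -/
theorem rigorousRGSmallParameter_of_criticalCurve
    (h : LongRangePhi4.Slade2017_criticalCurve) : RigorousRGSmallParameter :=
  LongRangePhi4.Slade2017_thm141_of_criticalCurve h

namespace LongRangePhi4

/-! ### Barrier audit 2026-08-17: the continuity clause (a) is load-bearing -/

/-- The two-valued weight of the audit's step curve: `ρ` on the "lower part"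
`(2^{-(k+1)}, ¾·2^{-k}]` of a dyadic piece, `1` on its "upper part" `(¾·2^{-k}, 2^{-k}]`.
[folklore] -/
def gapWeight (ρ m2 : ℝ) : ℝ :=
  open Classical in
  if ∃ k : ℕ, (1 / 2 : ℝ) ^ (k + 1) < m2 ∧ m2 ≤ 3 / 4 * (1 / 2 : ℝ) ^ k then ρ else 1

/-- The audit's step curve `ν*(m²) = (m²)^{1-θ} · w(m²)`, `w ∈ {ρ, 1}` the dyadic weight: a
discontinuous "critical curve". [folklore] -/
def gapCurve (θ ρ m2 : ℝ) : ℝ := m2 ^ (1 - θ) * gapWeight ρ m2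

/-- The audit's susceptibility `χ(ν) = ν^{-1/(1-θ)}` (the pure power law with
`-χ^{-2+θ}χ' ≡ 1/(1-θ)`). [folklore] -/
def gapSusceptibility (θ ν : ℝ) : ℝ := ν ^ (-(1 / (1 - θ)))

/-- The weight takes only the values `ρ` and `1`. [folklore] -/
theorem gapWeight_eq_or (ρ m2 : ℝ) : gapWeight ρ m2 = ρ ∨ gapWeight ρ m2 = 1 := by
  unfold gapWeight
  split_ifs
  · exact Or.inl rfl
  · exact Or.inr rfl

/-- On a lower part the weight is `ρ`. [folklore] -/
theorem gapWeight_of_lower {ρ m2 : ℝ} {k : ℕ} (h1 : (1 / 2 : ℝ) ^ (k + 1) < m2)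
    (h2 : m2 ≤ 3 / 4 * (1 / 2 : ℝ) ^ k) : gapWeight ρ m2 = ρ := by
  unfold gapWeight
  rw [if_pos ⟨k, h1, h2⟩]

/-- Off the lower parts the weight is `1`. [folklore] -/
theorem gapWeight_of_not_lower {ρ m2 : ℝ}
    (h : ¬ ∃ k : ℕ, (1 / 2 : ℝ) ^ (k + 1) < m2 ∧ m2 ≤ 3 / 4 * (1 / 2 : ℝ) ^ k) :
    gapWeight ρ m2 = 1 := by
  unfold gapWeight
  rw [if_neg h]

/-- `ρ ≤ w ≤ 1` when `ρ ≤ 1`. [folklore] -/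
theorem gapWeight_mem {ρ : ℝ} (hρ1 : ρ ≤ 1) (m2 : ℝ) :
    ρ ≤ gapWeight ρ m2 ∧ gapWeight ρ m2 ≤ 1 := by
  rcases gapWeight_eq_or ρ m2 with h | h <;> rw [h]
  · exact ⟨le_rfl, hρ1⟩
  · exact ⟨hρ1, le_rfl⟩

/-- The weight is positive when `0 < ρ ≤ 1`. [folklore] -/
theorem gapWeight_pos {ρ : ℝ} (hρ0 : 0 < ρ) (hρ1 : ρ ≤ 1) (m2 : ℝ) : 0 < gapWeight ρ m2 :=
  hρ0.trans_le (gapWeight_mem hρ1 m2).1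

/-- The step curve starts at `ν*(0) = 0` (`θ < 1`). [folklore] -/
theorem gapCurve_zero {θ : ℝ} (hθ : θ < 1) (ρ : ℝ) : gapCurve θ ρ 0 = 0 := by
  unfold gapCurve
  rw [Real.zero_rpow (by linarith), zero_mul]

/-- The step curve is positive for `m² > 0`. [folklore] -/
theorem gapCurve_pos {θ ρ : ℝ} (hρ0 : 0 < ρ) (hρ1 : ρ ≤ 1) {m2 : ℝ} (hm2 : 0 < m2) :
    0 < gapCurve θ ρ m2 :=
  mul_pos (Real.rpow_pos_of_pos hm2 _) (gapWeight_pos hρ0 hρ1 m2)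

/-- `m² · χ(ν*(m²)) = w(m²)^{-γ}`, `γ = 1/(1-θ)`. [folklore] -/
theorem mul_gapSusceptibility_gapCurve {θ ρ : ℝ} (hθ : θ < 1) (hρ0 : 0 < ρ) (hρ1 : ρ ≤ 1)
    {m2 : ℝ} (hm2 : 0 < m2) :
    m2 * gapSusceptibility θ (gapCurve θ ρ m2) = gapWeight ρ m2 ^ (-(1 / (1 - θ))) := by
  have h1θ : (1 - θ) ≠ 0 := by linarith
  have hw := gapWeight_pos hρ0 hρ1 m2
  unfold gapSusceptibility gapCurve
  rw [Real.mul_rpow (Real.rpow_nonneg hm2.le _) hw.le, ← Real.rpow_mul hm2.le,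
    show (1 - θ) * -(1 / (1 - θ)) = -1 by field_simp, Real.rpow_neg_one, ← mul_assoc,
    mul_inv_cancel₀ hm2.ne', one_mul]

/-- `(ν*(m²))^{-γ-1} = (m²)^{-2+θ} w^{-γ-1}` (since `(1-θ)(γ+1) = 2-θ`). [folklore] -/
theorem gapCurve_rpow {θ ρ : ℝ} (hθ : θ < 1) (hρ0 : 0 < ρ) (hρ1 : ρ ≤ 1) {m2 : ℝ}
    (hm2 : 0 < m2) :
    gapCurve θ ρ m2 ^ (-(1 / (1 - θ)) - 1) =
      m2 ^ (-2 + θ) * gapWeight ρ m2 ^ (-(1 / (1 - θ)) - 1) := by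
  have h1θ : (1 - θ) ≠ 0 := by linarith
  have hw := gapWeight_pos hρ0 hρ1 m2
  unfold gapCurve
  rw [Real.mul_rpow (Real.rpow_nonneg hm2.le _) hw.le, ← Real.rpow_mul hm2.le]
  congr 2
  field_simp
  ring


/-- **The gap points.** For `k ∈ ℕ` the point `p_k = (¾·2^{-k})^{1-θ} · (1+ρ)/2` is NOT on the
step curve: it lies strictly between the top of the lower part and the bottom of the upper part
of the `k`-th dyadic piece (uses `(2/3)^{1-θ} < (1+ρ)/2` and `(1+ρ)/(2ρ) < (4/3)^{1-θ}`, valid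
for `θ ≤ ½`, `ρ ≥ 10/11`). [folklore] -/
theorem gapPoint_not_mem {θ ρ : ℝ} (hθ : θ ≤ 1 / 2) (hρ0 : 10 / 11 ≤ ρ) (hρ1 : ρ < 1)
    (k : ℕ) :
    (3 / 4 * (1 / 2 : ℝ) ^ k) ^ (1 - θ) * ((1 + ρ) / 2) ∉ gapCurve θ ρ '' Ioi 0 := by
  rintro ⟨m2, hm2 : 0 < m2, heq⟩
  set t : ℝ := 3 / 4 * (1 / 2 : ℝ) ^ k with ht
  have ht0 : 0 < t := by positivity
  have h1θ : 0 < 1 - θ := by linarith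
  have hρpos : 0 < ρ := by linarith
  have htpow : 0 < t ^ (1 - θ) := Real.rpow_pos_of_pos ht0 _
  -- two numerical facts
  have hA : (2 / 3 : ℝ) ^ (1 - θ) < (1 + ρ) / 2 := by
    have h1 : (2 / 3 : ℝ) ^ (1 - θ) ≤ (2 / 3 : ℝ) ^ (1 / 2 : ℝ) :=
      Real.rpow_le_rpow_of_exponent_ge (by norm_num) (by norm_num) (by linarith)
    have h2 : (2 / 3 : ℝ) ^ (1 / 2 : ℝ) < 21 / 25 := by
      rw [← Real.sqrt_eq_rpow, Real.sqrt_lt' (by norm_num)]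
      norm_num
    linarith
  have hB : (1 + ρ) / (2 * ρ) < (4 / 3 : ℝ) ^ (1 - θ) := by
    have h1 : (4 / 3 : ℝ) ^ (1 / 2 : ℝ) ≤ (4 / 3 : ℝ) ^ (1 - θ) :=
      Real.rpow_le_rpow_of_exponent_le (by norm_num) (by linarith)
    have h2 : (23 / 20 : ℝ) < (4 / 3 : ℝ) ^ (1 / 2 : ℝ) := by
      rw [← Real.sqrt_eq_rpow, Real.lt_sqrt (by norm_num)]
      norm_num
    have h3 : (1 + ρ) / (2 * ρ) ≤ 23 / 20 := by
      rw [div_le_iff₀ (by linarith)]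
      linarith
    linarith
  rcases gapWeight_eq_or ρ m2 with hw | hw
  · -- `w(m²) = ρ`: `m²` lies in some lower part, yet `t < m² < 2^{-k}` — contradiction
    have hlow : ∃ k' : ℕ, (1 / 2 : ℝ) ^ (k' + 1) < m2 ∧ m2 ≤ 3 / 4 * (1 / 2 : ℝ) ^ k' := by
      by_contra h
      rw [gapWeight_of_not_lower h] at hw
      linarith
    obtain ⟨k', hk'1, hk'2⟩ := hlow
    unfold gapCurve at heq
    rw [hw] at heq
    have hm2pow : m2 ^ (1 - θ) = t ^ (1 - θ) * ((1 + ρ) / (2 * ρ)) := by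
      have : m2 ^ (1 - θ) = m2 ^ (1 - θ) * ρ / ρ := by field_simp
      rw [this, heq]
      field_simp
    have hgt : t < m2 := by
      have h1 : 1 < (1 + ρ) / (2 * ρ) := by
        rw [one_lt_div (by linarith)]
        linarith
      have : t ^ (1 - θ) < m2 ^ (1 - θ) := by
        rw [hm2pow]
        nlinarith
      exact (Real.rpow_lt_rpow_iff ht0.le hm2.le h1θ).1 this
    have hlt : m2 < (1 / 2 : ℝ) ^ k := by
      have : m2 ^ (1 - θ) < ((1 / 2 : ℝ) ^ k) ^ (1 - θ) := by
        rw [hm2pow]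
        calc t ^ (1 - θ) * ((1 + ρ) / (2 * ρ)) < t ^ (1 - θ) * (4 / 3 : ℝ) ^ (1 - θ) :=
              mul_lt_mul_of_pos_left hB htpow
          _ = (t * (4 / 3)) ^ (1 - θ) := by rw [Real.mul_rpow ht0.le (by norm_num)]
          _ = ((1 / 2 : ℝ) ^ k) ^ (1 - θ) := by
              congr 1
              rw [ht]
              ring
      exact (Real.rpow_lt_rpow_iff hm2.le (by positivity) h1θ).1 this
    have hkk' : k ≤ k' := by
      by_contra hlt'
      push Not at hlt'
      have : (1 / 2 : ℝ) ^ k ≤ (1 / 2 : ℝ) ^ (k' + 1) :=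
        pow_le_pow_of_le_one (by norm_num) (by norm_num) (by omega)
      linarith
    have : (1 / 2 : ℝ) ^ k' ≤ (1 / 2 : ℝ) ^ k :=
      pow_le_pow_of_le_one (by norm_num) (by norm_num) hkk'
    linarith
  · -- `w(m²) = 1`: `m²` lies in no lower part, yet `2^{-(k+1)} < m² < t` — contradiction
    have hnot : ¬ ∃ k' : ℕ, (1 / 2 : ℝ) ^ (k' + 1) < m2 ∧ m2 ≤ 3 / 4 * (1 / 2 : ℝ) ^ k' := by
      rintro ⟨k', hk'1, hk'2⟩
      rw [gapWeight_of_lower hk'1 hk'2] at hw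
      linarith
    unfold gapCurve at heq
    rw [hw, mul_one] at heq
    have hlt : m2 < t := by
      have : m2 ^ (1 - θ) < t ^ (1 - θ) := by
        rw [heq]
        nlinarith
      exact (Real.rpow_lt_rpow_iff hm2.le ht0.le h1θ).1 this
    have hgt : (1 / 2 : ℝ) ^ (k + 1) < m2 := by
      have : ((1 / 2 : ℝ) ^ (k + 1)) ^ (1 - θ) < m2 ^ (1 - θ) := by
        rw [heq]
        calc ((1 / 2 : ℝ) ^ (k + 1)) ^ (1 - θ) = (t * (2 / 3)) ^ (1 - θ) := by
              congr 1
              rw [ht]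
              ring
          _ = t ^ (1 - θ) * (2 / 3 : ℝ) ^ (1 - θ) := Real.mul_rpow ht0.le (by norm_num)
          _ < t ^ (1 - θ) * ((1 + ρ) / 2) := mul_lt_mul_of_pos_left hA htpow
      exact (Real.rpow_lt_rpow_iff (by positivity) hm2.le h1θ).1 this
    exact hnot ⟨k, hgt, hlt.le⟩

/-- The gap points accumulate at `0`. [folklore] -/
theorem gapPoint_small {θ ρ : ℝ} (hθ : θ ≤ 1 / 2) (hρ0 : 0 ≤ ρ) (hρ1 : ρ ≤ 1) {η : ℝ}
    (hη : 0 < η) :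
    ∃ k : ℕ, 0 < (3 / 4 * (1 / 2 : ℝ) ^ k) ^ (1 - θ) * ((1 + ρ) / 2) ∧
      (3 / 4 * (1 / 2 : ℝ) ^ k) ^ (1 - θ) * ((1 + ρ) / 2) < η := by
  have hη1 : 0 < min η 1 := lt_min hη one_pos
  obtain ⟨k, hk⟩ := exists_pow_lt_of_lt_one (show 0 < min η 1 ^ 2 by positivity)
    (show (1 / 2 : ℝ) < 1 by norm_num)
  refine ⟨k, by positivity, ?_⟩
  set t : ℝ := 3 / 4 * (1 / 2 : ℝ) ^ k with ht
  have ht0 : 0 < t := by positivity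
  have hpow0 : 0 ≤ (1 / 2 : ℝ) ^ k := pow_nonneg (by norm_num) k
  have ht1 : t < min η 1 ^ 2 := by
    have : t ≤ (1 / 2 : ℝ) ^ k := by rw [ht]; linarith
    linarith
  have hmin1 : min η 1 ≤ 1 := min_le_right _ _
  have ht_le_one : t ≤ 1 := by nlinarith
  have h1 : t ^ (1 - θ) ≤ t ^ (1 / 2 : ℝ) :=
    Real.rpow_le_rpow_of_exponent_ge ht0 ht_le_one (by linarith)
  have h2 : t ^ (1 / 2 : ℝ) < min η 1 := by
    rw [← Real.sqrt_eq_rpow, Real.sqrt_lt' hη1]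
    exact ht1
  have h3 : (1 + ρ) / 2 ≤ 1 := by linarith
  calc t ^ (1 - θ) * ((1 + ρ) / 2) ≤ t ^ (1 - θ) * 1 :=
        mul_le_mul_of_nonneg_left h3 (Real.rpow_nonneg ht0.le _)
    _ < η := by
        rw [mul_one]
        linarith [min_le_left η 1]

/-- **The step curve is discontinuous** (at `m² = 3/8`, say): by the intermediate value theorem a
continuous curve on `[3/8, 1/2]` would pass through the gap point `p₁`. [folklore] -/
theorem gapCurve_not_continuousOn {θ ρ : ℝ} (hθ : θ ≤ 1 / 2) (hρ0 : 10 / 11 ≤ ρ)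
    (hρ1 : ρ < 1) {δ : ℝ} (hδ : 1 / 2 ≤ δ) :
    ¬ ContinuousOn (gapCurve θ ρ) (Icc 0 δ) := by
  intro hcont
  have h1θ : 0 < 1 - θ := by linarith
  have hsub : Icc (3 / 8 : ℝ) (1 / 2) ⊆ Icc 0 δ := Icc_subset_Icc (by norm_num) hδ
  have hivt := intermediate_value_Icc (show (3 / 8 : ℝ) ≤ 1 / 2 by norm_num) (hcont.mono hsub)
  have ha : gapCurve θ ρ (3 / 8) = (3 / 8 : ℝ) ^ (1 - θ) * ρ := by
    unfold gapCurve
    rw [gapWeight_of_lower (k := 1) (by norm_num) (by norm_num)]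
  have hb : gapCurve θ ρ (1 / 2) = (1 / 2 : ℝ) ^ (1 - θ) := by
    unfold gapCurve
    rw [gapWeight_of_not_lower, mul_one]
    rintro ⟨k, hk1, hk2⟩
    rcases Nat.eq_zero_or_pos k with rfl | hk
    · norm_num at hk1
    · have : (1 / 2 : ℝ) ^ k ≤ (1 / 2 : ℝ) ^ 1 := pow_le_pow_of_le_one (by norm_num) (by norm_num) hk
      linarith
  have hp := gapPoint_not_mem hθ hρ0 hρ1 1
  rw [show (3 / 4 * (1 / 2 : ℝ) ^ 1) = 3 / 8 by norm_num] at hp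
  have h38 : 0 < (3 / 8 : ℝ) ^ (1 - θ) := Real.rpow_pos_of_pos (by norm_num) _
  have hmem : (3 / 8 : ℝ) ^ (1 - θ) * ((1 + ρ) / 2) ∈
      Icc (gapCurve θ ρ (3 / 8)) (gapCurve θ ρ (1 / 2)) := by
    rw [ha, hb]
    constructor
    · exact mul_le_mul_of_nonneg_left (by linarith) h38.le
    · calc (3 / 8 : ℝ) ^ (1 - θ) * ((1 + ρ) / 2) ≤ (3 / 8 : ℝ) ^ (1 - θ) * 1 :=
            mul_le_mul_of_nonneg_left (by linarith) h38.le
        _ ≤ (1 / 2 : ℝ) ^ (1 - θ) := by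
            rw [mul_one]
            exact Real.rpow_le_rpow (by norm_num) (by norm_num) h1θ.le
  obtain ⟨m2, hm2, hm2eq⟩ := hivt hmem
  exact hp ⟨m2, (show (0 : ℝ) < 3 / 8 by norm_num).trans_le hm2.1, hm2eq⟩

/-- **No divergent interval.** With the step curve and `χ(ν) = ν^{-1/(1-θ)}` there is no `ν_c`
and `η > 0` with `(ν_c, ν_c + η]` inside the image of the curve and `χ → ∞` at `ν_c⁺` — the
shape of the conclusion of Theorem 8.3.1 (`N₊ = (ν_c, ν_c + η]`, divergence at `ν_c`): for
`ν_c < 0` the interval leaves `(0, ∞) ⊇ image`, for `ν_c > 0` the power law is continuous at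
`ν_c`, and for `ν_c = 0` the gap points accumulate at `0`. [folklore] -/
theorem gapCurve_no_divergent_interval {θ ρ : ℝ} (hθ : θ ≤ 1 / 2) (hρ0 : 10 / 11 ≤ ρ)
    (hρ1 : ρ < 1) (δ : ℝ) :
    ¬ ∃ νc η : ℝ, 0 < η ∧ Ioc νc (νc + η) ⊆ gapCurve θ ρ '' Ioc 0 δ ∧
        Tendsto (gapSusceptibility θ) (𝓝[>] νc) atTop := by
  rintro ⟨νc, η, hη, hsub, hdiv⟩
  have hρpos : 0 < ρ := by linarith
  have himg_pos : ∀ ν ∈ gapCurve θ ρ '' Ioc 0 δ, 0 < ν := by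
    rintro ν ⟨m2, hm2, rfl⟩
    exact gapCurve_pos hρpos hρ1.le hm2.1
  rcases lt_trichotomy νc 0 with hneg | rfl | hpos
  · have hmem : min (νc / 2) (νc + η) ∈ Ioc νc (νc + η) :=
      ⟨lt_min (by linarith) (by linarith), min_le_right _ _⟩
    have := himg_pos _ (hsub hmem)
    linarith [min_le_left (νc / 2) (νc + η)]
  · obtain ⟨k, hk0, hkη⟩ := gapPoint_small hθ hρpos.le hρ1.le hη
    have hmem : (3 / 4 * (1 / 2 : ℝ) ^ k) ^ (1 - θ) * ((1 + ρ) / 2) ∈ Ioc (0 : ℝ) (0 + η) :=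
      ⟨hk0, by linarith⟩
    obtain ⟨m2, hm2, hm2eq⟩ := hsub hmem
    exact gapPoint_not_mem hθ hρ0 hρ1 k ⟨m2, hm2.1, hm2eq⟩
  · have hcont : ContinuousAt (gapSusceptibility θ) νc := by
      unfold gapSusceptibility
      exact Real.continuousAt_rpow_const νc _ (Or.inl hpos.ne')
    have h1 : Tendsto (gapSusceptibility θ) (𝓝[>] νc) (𝓝 (gapSusceptibility θ νc)) :=
      hcont.tendsto.mono_left nhdsWithin_le_nhds
    exact h1.not_tendsto (disjoint_nhds_atTop _) hdiv

/-- **Clauses (b) and (c) of `Slade2017_criticalCurve` hold for the step curve**, with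
`ρ = (1+τ)^{-(1-θ)}` (so that `m²χ(ν*(m²)) = w^{-γ} ∈ {1, 1+τ}`) and
`-χ'(ν*(m²)) = γ w^{-γ-1} (m²)^{-2+θ}`, `γ w^{-γ-1} ∈ [1, 2.42]`. [folklore] -/
theorem gapCurve_clauses {θ κ τ C ρ : ℝ} (hθ0 : 0 ≤ θ) (hθ : θ ≤ 1 / 2) (hκ : 0 ≤ κ)
    (hτ0 : 0 < τ) (hτ : τ ≤ 1 / 10) (hC : 3 ≤ C) (hρ : ρ = (1 + τ) ^ (-(1 - θ))) :
    10 / 11 ≤ ρ ∧ ρ < 1 ∧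
    (∀ m2 : ℝ, 0 < m2 → |m2 * gapSusceptibility θ (gapCurve θ ρ m2) - 1| ≤ τ) ∧
    (∀ m2 : ℝ, 0 < m2 → m2 ≤ 1 → ∃ D : ℝ,
        HasDerivAt (gapSusceptibility θ) D (gapCurve θ ρ m2) ∧
        C⁻¹ * m2 ^ (-2 + θ + κ) ≤ -D ∧ -D ≤ C * m2 ^ (-2 + θ - κ)) := by
  have h1θ : 0 < 1 - θ := by linarith
  have h1τ : 1 ≤ 1 + τ := by linarith
  have hρ1 : ρ < 1 := by
    rw [hρ]
    exact Real.rpow_lt_one_of_one_lt_of_neg (by linarith) (by linarith)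
  have hρ0 : 10 / 11 ≤ ρ := by
    have h1 : (1 + τ) ^ (-(1 : ℝ)) ≤ ρ := by
      rw [hρ]
      exact Real.rpow_le_rpow_of_exponent_le h1τ (by linarith)
    rw [Real.rpow_neg_one] at h1
    have h2 : (10 / 11 : ℝ) ≤ (1 + τ)⁻¹ := by
      rw [le_inv_comm₀ (by norm_num) (by linarith)]
      linarith
    exact h2.trans h1
  have hρpos : 0 < ρ := by linarith
  have hγpos : 0 < 1 / (1 - θ) := by positivity
  have hργ : ρ ^ (-(1 / (1 - θ))) = 1 + τ := by
    rw [hρ, ← Real.rpow_mul (by linarith),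
      show (-(1 - θ)) * -(1 / (1 - θ)) = 1 by field_simp, Real.rpow_one]
  have hργ1 : ρ ^ (-(1 / (1 - θ)) - 1) ≤ 121 / 100 := by
    rw [hρ, ← Real.rpow_mul (by linarith),
      show (-(1 - θ)) * (-(1 / (1 - θ)) - 1) = 2 - θ by field_simp; ring]
    calc (1 + τ) ^ (2 - θ) ≤ (1 + τ) ^ (2 : ℝ) :=
          Real.rpow_le_rpow_of_exponent_le h1τ (by linarith)
      _ = (1 + τ) ^ (2 : ℕ) := by exact_mod_cast Real.rpow_natCast (1 + τ) 2
      _ ≤ 121 / 100 := by nlinarith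
  refine ⟨hρ0, hρ1, ?_, ?_⟩
  · intro m2 hm2
    rw [mul_gapSusceptibility_gapCurve (by linarith) hρpos hρ1.le hm2]
    rcases gapWeight_eq_or ρ m2 with hw | hw <;> rw [hw]
    · rw [hργ, add_sub_cancel_left, abs_of_pos hτ0]
    · rw [Real.one_rpow, sub_self, abs_zero]
      exact hτ0.le
  · intro m2 hm2 hm21
    have hν := gapCurve_pos (θ := θ) hρpos hρ1.le hm2
    have hw := gapWeight_mem hρ1.le m2
    have hwpos := gapWeight_pos hρpos hρ1.le m2
    have hpos2 : 0 < m2 ^ (-2 + θ) := Real.rpow_pos_of_pos hm2 _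
    refine ⟨-(1 / (1 - θ)) * gapCurve θ ρ m2 ^ (-(1 / (1 - θ)) - 1), ?_, ?_, ?_⟩
    · unfold gapSusceptibility
      exact Real.hasDerivAt_rpow_const (Or.inl hν.ne')
    · rw [gapCurve_rpow (by linarith) hρpos hρ1.le hm2, neg_mul, neg_neg]
      have hwγ : 1 ≤ gapWeight ρ m2 ^ (-(1 / (1 - θ)) - 1) :=
        Real.one_le_rpow_of_pos_of_le_one_of_nonpos hwpos hw.2 (by linarith)
      have hγ1 : 1 ≤ 1 / (1 - θ) := by
        rw [le_div_iff₀ h1θ]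
        linarith
      have hm2pow : m2 ^ (-2 + θ + κ) ≤ m2 ^ (-2 + θ) :=
        Real.rpow_le_rpow_of_exponent_ge hm2 hm21 (by linarith)
      have hC1 : C⁻¹ ≤ 1 := inv_le_one_of_one_le₀ (by linarith)
      calc C⁻¹ * m2 ^ (-2 + θ + κ) ≤ 1 * m2 ^ (-2 + θ) :=
            mul_le_mul hC1 hm2pow (Real.rpow_nonneg hm2.le _) zero_le_one
        _ = 1 * (m2 ^ (-2 + θ) * 1) := by ring
        _ ≤ 1 / (1 - θ) * (m2 ^ (-2 + θ) * gapWeight ρ m2 ^ (-(1 / (1 - θ)) - 1)) :=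
            mul_le_mul hγ1 (mul_le_mul_of_nonneg_left hwγ hpos2.le) (by positivity)
              (by positivity)
    · rw [gapCurve_rpow (by linarith) hρpos hρ1.le hm2, neg_mul, neg_neg]
      have hwγ : gapWeight ρ m2 ^ (-(1 / (1 - θ)) - 1) ≤ ρ ^ (-(1 / (1 - θ)) - 1) :=
        Real.rpow_le_rpow_of_nonpos hρpos hw.1 (by linarith)
      have hγ2 : 1 / (1 - θ) ≤ 2 := by
        rw [div_le_iff₀ h1θ]
        linarith
      have hm2pow : m2 ^ (-2 + θ) ≤ m2 ^ (-2 + θ - κ) :=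
        Real.rpow_le_rpow_of_exponent_ge hm2 hm21 (by linarith)
      have hm2pos' : 0 ≤ m2 ^ (-2 + θ - κ) := Real.rpow_nonneg hm2.le _
      calc 1 / (1 - θ) * (m2 ^ (-2 + θ) * gapWeight ρ m2 ^ (-(1 / (1 - θ)) - 1))
          ≤ 2 * (m2 ^ (-2 + θ - κ) * (121 / 100)) :=
            mul_le_mul hγ2 (mul_le_mul hm2pow (hwγ.trans hργ1) (by positivity) hm2pos')
              (by positivity) (by norm_num)
        _ ≤ C * m2 ^ (-2 + θ - κ) := by nlinarith

/-- **Barrier audit (2026-08-17): clause (a) of `Slade2017_criticalCurve` — continuity of the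
critical curve — is load-bearing for Theorem 8.3.1, and its printed proof has a gap.**

*The gap in print.* The proof of Theorem 8.3.1 (p. 37) takes "`ν* : [0,δ] → ℝ` is continuous by
Corollaries 7.2.4–7.2.5". Corollary 7.2.4 (p. 30) proves that the fixed point of `T`, hence
`μ₀(m̃², m²)`, is jointly continuous on
`Δ = {(m̃², m²) ∈ (0,∞) × [0,δ] : j_m̃ ≤ j_m − (J_L+2)}` (§7.2.2, p. 29; this is what the
sawtooth smoothing `(1 − δ_m̃)` of Lemma 7.2.1 is for), and then says "In particular, `μ₀(m²)`
is continuous in `m² ∈ (0,δ]`", where `μ₀(m²) := μ₀(m²₋(m²), m²)` and "`m²₋` (a function of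
`m²`) is the least value of `u²` for which `j_u = j_m − (J_L+2)`" (pp. 29–30). Since the mass
scale `j_m = ⌈1 + α⁻¹ log_L m⁻²⌉` (§3.4, p. 13) is a step function of `m²`, so is
`m² ↦ m²₋(m²)` (it jumps by the factor `L^{-α}` at the masses `m² = L^{-αk}`, which accumulate
at `0`), and joint continuity on `Δ` alone does not yield continuity of the composite at those
masses, where the selected point `(m²₋(m²), m²)` jumps in `Δ` (`T`, and with it its fixed point,
depends on `m̃²` through the cut-off scale `j_m̃` and the smoothing factor `(1 − δ_m̃)`; that
dependence is what Lemma 7.2.1 is about, and no independence of `μ₀(m̃², m²)` from `m̃²` is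
claimed in print). *Repair* (not printed): select the auxiliary mass continuously,
`m̃²(m²) := L^{α(J_L+3)}m²`, which lies in `Δ` (`f_m̃ = f_m − (J_L+3)`, so
`j_m̃ = j_m − J_L − 3`), so that `m² ↦ μ₀(m̃²(m²), m²)` is continuous on `(0,δ]` by Corollary
7.2.4 as printed, and run the forward extension of Lemma 7.2.7 over `J_L + O(1)` instead of
`J_L` scales; Corollary 7.2.5, Theorem 7.3.1 and §8 do not appear to use the minimality of
`m̃²`. The named fact `Slade2017_criticalCurve` only asks for SOME continuous `ν*` and is
insensitive to the selection; its clause (a) should be read with this repair.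

*Load-bearing.* This theorem: for every admissible exponent data (`0 ≤ θ ≤ ½` standing for
`γ̂ε/α`, `κ ≥ 0` for `Cε²`, tolerance `0 < τ ≤ 1/10` for `C s̄`, any constant `C ≥ 3`) there are
a curve `ν*` and a function `χ` satisfying clauses (b) and (c) of `Slade2017_criticalCurve`
verbatim on `(0, ½]` (the model conjunct `HasSusceptibility`, which identifies `χ(ν*(m²))` with
the infinite-volume susceptibility, aside) — `|m²χ(ν*(m²)) − 1| ≤ τ`, `χ` differentiable at
`ν*(m²)` with
`C⁻¹(m²)^{-2+θ+κ} ≤ −χ' ≤ C(m²)^{-2+θ-κ}` — for which `ν*` is NOT continuous, the image of the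
curve misses points `ν` arbitrarily close to `ν_c = ν*(0) = 0`, and the conclusion of Theorem
8.3.1 in the shape used downstream ("`N₊ = (ν_c, ν_c + η]` and `χ ↑ ∞` as `ν ↓ ν_c`": some
right-neighbourhood `(ν_c, ν_c + η]` inside the image with `χ → ∞` at `ν_c⁺`) FAILS. Witness:
`χ(ν) = ν^{-1/(1-θ)}` and the step curve `ν*(m²) = (m²)^{1-θ}w(m²)`, `w = (1+τ)^{-(1-θ)}` on the
lower parts `(2^{-(k+1)}, ¾2^{-k}]` of the dyadic pieces and `w = 1` on the upper parts
(`gapCurve`, `gapSusceptibility`, `gapPoint_not_mem`, `gapCurve_no_divergent_interval`).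
So the soft §8.3 step proved in this file genuinely consumes clause (a); clauses (b)–(c) (the
quantitative renormalisation-group output) do not determine the critical point by themselves.
[cite: Slade2017, Corollary 7.2.4 and its proof; §7.2.2 (definition of Δ and m²₋); §3.4
(definition of the mass scale j_m); proof of Theorem 8.3.1] -/
theorem criticalCurve_continuity_loadBearing {θ κ τ C : ℝ} (hθ0 : 0 ≤ θ) (hθ : θ ≤ 1 / 2)
    (hκ : 0 ≤ κ) (hτ0 : 0 < τ) (hτ : τ ≤ 1 / 10) (hC : 3 ≤ C) :
    ∃ νstar χ : ℝ → ℝ,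
      νstar 0 = 0 ∧
      (∀ m2 ∈ Ioc (0 : ℝ) (1 / 2), 0 < νstar m2 ∧ |m2 * χ (νstar m2) - 1| ≤ τ) ∧
      (∀ m2 ∈ Ioo (0 : ℝ) (1 / 2), ∃ D : ℝ, HasDerivAt χ D (νstar m2) ∧
          C⁻¹ * m2 ^ (-2 + θ + κ) ≤ -D ∧ -D ≤ C * m2 ^ (-2 + θ - κ)) ∧
      ¬ ContinuousOn νstar (Icc 0 (1 / 2)) ∧
      (∀ η : ℝ, 0 < η → ∃ ν ∈ Ioo 0 η, ν ∉ νstar '' Ioi 0) ∧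
      ¬ ∃ νc η : ℝ, 0 < η ∧ Ioc νc (νc + η) ⊆ νstar '' Ioc 0 (1 / 2) ∧
          Tendsto χ (𝓝[>] νc) atTop := by
  set ρ : ℝ := (1 + τ) ^ (-(1 - θ)) with hρ
  obtain ⟨hρ0, hρ1, hb, hc⟩ := gapCurve_clauses (κ := κ) hθ0 hθ hκ hτ0 hτ hC hρ
  have hρpos : 0 < ρ := by linarith
  refine ⟨gapCurve θ ρ, gapSusceptibility θ, gapCurve_zero (by linarith) ρ,
    fun m2 hm2 => ⟨gapCurve_pos hρpos hρ1.le hm2.1, hb m2 hm2.1⟩,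
    fun m2 hm2 => hc m2 hm2.1 (by linarith [hm2.2]),
    gapCurve_not_continuousOn hθ hρ0 hρ1 le_rfl, fun η hη => ?_,
    gapCurve_no_divergent_interval hθ hρ0 hρ1 (1 / 2)⟩
  obtain ⟨k, hk0, hkη⟩ := gapPoint_small hθ hρpos.le hρ1.le hη
  exact ⟨_, ⟨hk0, hkη⟩, gapPoint_not_mem hθ hρ0 hρ1 k⟩

/-- **Clauses (b)–(c) of `Slade2017_criticalCurve` in their literal shape do not give Theorem
8.3.1 without clause (a).** For `d ≥ 1`, every `n`, every `ε ∈ (0, ¼]`, every constant `C ≥ 3`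
and every `s̄ > 0` there are `δ > 0` (namely `½`), a curve `ν*` and a function `χ` satisfying,
word for word, the two conjuncts of the named fact that follow `ContinuousOn νstar (Icc 0 δ)`
(with the model clause `HasSusceptibility` — the identification of `χ(ν*(m²))` with the
infinite-volume susceptibility — left aside, as in `powerLaw_clauses_literal`), such that `ν*` is
not continuous on `[0,δ]` and no `ν_c`, `η > 0` have `(ν_c, ν_c+η] ⊆ ν*((0,δ])` with `χ → ∞` at
`ν_c⁺`. Instance of `criticalCurve_continuity_loadBearing` with `θ = (n+2)/(n+8)·ε/α ≤ 2ε ≤ ½`,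
`κ = Cε²`, `τ = min (C s̄) (1/10)`. [folklore] -/
theorem Slade2017_criticalCurve_clauses_bc_literal (d n : ℕ) (hd : 1 ≤ d) {ε : ℝ} (hε : 0 < ε)
    (hε4 : ε ≤ 1 / 4) {C : ℝ} (hC : 3 ≤ C) {s : ℝ} (hs : 0 < s) :
    ∃ δ : ℝ, 0 < δ ∧ ∃ νstar χ : ℝ → ℝ,
      (∀ m2 ∈ Ioc 0 δ, |m2 * χ (νstar m2) - 1| ≤ C * s) ∧
      (∀ m2 ∈ Ioo 0 δ, ∃ D : ℝ, HasDerivAt χ D (νstar m2) ∧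
        C⁻¹ * m2 ^ (-2 + ((n : ℝ) + 2) / ((n : ℝ) + 8) * (ε / ((d + ε) / 2)) + C * ε ^ 2)
            ≤ -D ∧
        -D ≤ C * m2 ^ (-2 + ((n : ℝ) + 2) / ((n : ℝ) + 8) * (ε / ((d + ε) / 2))
            - C * ε ^ 2)) ∧
      ¬ ContinuousOn νstar (Icc 0 δ) ∧
      ¬ ∃ νc η : ℝ, 0 < η ∧ Ioc νc (νc + η) ⊆ νstar '' Ioc 0 δ ∧
          Tendsto χ (𝓝[>] νc) atTop := by
  have hd1 : (1 : ℝ) ≤ d := by exact_mod_cast hd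
  have hθ0 : 0 ≤ ((n : ℝ) + 2) / ((n : ℝ) + 8) * (ε / ((d + ε) / 2)) := by positivity
  have hθ2 : ((n : ℝ) + 2) / ((n : ℝ) + 8) * (ε / ((d + ε) / 2)) ≤ 2 * ε := by
    have h1 : ((n : ℝ) + 2) / ((n : ℝ) + 8) ≤ 1 := by
      rw [div_le_one (by positivity)]
      linarith
    have h2 : ε / ((d + ε) / 2) ≤ 2 * ε := by
      rw [div_le_iff₀ (by positivity)]
      nlinarith
    calc ((n : ℝ) + 2) / ((n : ℝ) + 8) * (ε / ((d + ε) / 2))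
        ≤ 1 * (2 * ε) := mul_le_mul h1 h2 (by positivity) zero_le_one
      _ = 2 * ε := one_mul _
  generalize ((n : ℝ) + 2) / ((n : ℝ) + 8) * (ε / ((d + ε) / 2)) = θ at hθ0 hθ2
  have hθ : θ ≤ 1 / 2 := by linarith
  have hκ : 0 ≤ C * ε ^ 2 := by
    have : 0 ≤ C := by linarith
    positivity
  have hτ0 : 0 < min (C * s) (1 / 10) := lt_min (by nlinarith) (by norm_num)
  have hτ : min (C * s) (1 / 10) ≤ 1 / 10 := min_le_right _ _
  obtain ⟨νstar, χ, -, hb, hc, hna, -, hno⟩ :=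
    criticalCurve_continuity_loadBearing hθ0 hθ hκ hτ0 hτ hC
  refine ⟨1 / 2, by norm_num, νstar, χ, fun m2 hm2 => ?_, fun m2 hm2 => ?_, hna, hno⟩
  · exact ((hb m2 hm2).2).trans (min_le_left _ _)
  · exact hc m2 hm2

end LongRangePhi4

end Literature.Barriers.CriticalPhenomena

end
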